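import Mathlib
import HarnessLib
import Summits.Ventures.LatticeQCDFlow.Exactness.EngineHMCTranslationCovariance
import Summits.Ventures.LatticeQCDFlow.Exactness.OpenBoundaryCenterSymmetry
import Summits.Ventures.LatticeQCDFlow.Scoring.HMCKernelCenterSymmetry

/-!
# Row 21's HMC arms as run commute with the global centre transformation; from a hot start `E_t[tr P] = 0` at every step of the periodic and of the open-boundary HMC run

HONEST FRAMING: exact (Metropolis-corrected) sampling algorithms for lattice gauge theory;
figures of merit are autocorrelation/cost numbers at stated couplings and volumes; no
continuum-physics claim.

Venture `LatticeQCDFlow` (cell pub-lqcd), topic `Exactness`, FANOUT row 21 (`su3-base`, arms `E2 = PBC-HMC` and `OBC-HMC` AS RUN,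
row 9's engine kernel `sunLeapfrogHMCN`).  NEW WORK of the cell: the centre-symmetry twin of row 21's
`EngineHMCTranslationCovariance` (relabellings) — here the symmetry MULTIPLIES the links by a central configuration (the
Literature's `centerTwist z t₀ = (twistConfig z t₀ * ·)`, `Barriers/QuantumFields/CenterSymmetryBreakingByQuarks`) and leaves the
momenta alone.  Row 21's `Scoring/HMCKernelCenterSymmetry` is the statement for row 16's kernel `hmcKernel` (its
`plaquetteLoopSum_centerTwist` — the staple loop sum is centre blind — is used here by name); `CMSweepCenterSymmetry` is arm E1's.
Def-free; nothing is cited as a fact; no number.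

* §1 `sunLeapfrogProposalN_centerMul` — for every configuration `c` of CENTRAL elements and every increment with `g(c·U) = g(U)`,
  `Ψ_n(c·U, p) = (c·(Ψ_n(U,p)).1, (Ψ_n(U,p)).2)` (the group drift `U ↦ e^{εp}·U` commutes with central left factors);
  **`conjKernel_sunLeapfrogHMCN_of_centerMul`** — for a measurable bijection `Θ` acting as `U ↦ c·U`, an increment with
  `g(c·U) = g(U)` and an action with `S(c·U) = S(U)`: `conjKernel K Θ = K`.
* §2 `sunWilsonForce_centerTwist` (the Wilson force is centre blind), `weightedLoopSum_centerTwist`, `sunWeightedForce_centerTwist`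
  (so is every plaquette-weighted force, in particular the open-boundary one); **`conjKernel_wilsonForce_sunLeapfrogHMCN_centerTwist`**,
  **`conjKernel_obcForce_sunLeapfrogHMCN_centerTwist`** — both arms as run commute with `centerTwist z t₀` for every central `z`,
  every slice `t₀`, every `β, ε, nstep, L` (and every open direction `τ`).
* §3 **`integral_wilsonHmcHotStart_tracePolyakov_eq_zero`**, **`integral_obcHmcHotStart_tracePolyakov_eq_zero`** — `SU(N)`,
  `N ≥ 2`: from the HOT start, at EVERY step `t` of either run, `E_t[tr P(y)] = 0` for every base site `y` (and every
  centre-covariant observable with phase `ω ≠ 1`: `integral_…_eq_zero_of_centerCovariant`).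
NOT CLAIMED: the cold start (`tr P = N` at step 0, no symmetry); stationarity; numbers.
-/

noncomputable section

namespace Summit.Ventures.LatticeQCDFlow.Exactness

open MeasureTheory ProbabilityTheory ProbabilityTheory.Kernel Set Function
open Literature.MathematicalPhysics.QuantumFieldTheory
open Literature.Barriers.QuantumFields (twistConfig centerTwist centerTwist_apply twistConfig_mem_center centerTwistEquiv
  centerTwistEquiv_apply map_centerTwist_pi_haar isCenterCovariant_tracePolyakov integral_eq_zero_of_covariant tracePolyakov
  plaquetteHolonomy_centerTwist wilsonAction_centerTwist)
open scoped ENNReal Matrix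

set_option backward.isDefEq.respectTransparency false

/-! ## §1 Central left factors commute with the `n`-step proposal -/

section Central

variable {n : Type*} [Fintype n] [DecidableEq n]
variable {E : Type*} [NormedAddCommGroup E] [NormedSpace ℝ E]
variable (ι : E →ₗ[ℝ] Matrix n n ℂ) (hι : ∀ a, (ι a)ᴴ = -ι a ∧ (ι a).trace = 0)
variable {Lk : Type*} (ε : ℝ) {g : (Lk → Matrix.specialUnitaryGroup n ℂ) → Lk → E}
variable {c : Lk → Matrix.specialUnitaryGroup n ℂ} (hc : ∀ l, c l ∈ Subgroup.center (Matrix.specialUnitaryGroup n ℂ))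
include hc

/-- The group drift commutes with a central left factor: `e^{εp}·(c·U) = c·(e^{εp}·U)`. -/
theorem sunExpDrift_mul_centerMul (p : Lk → E) (U : Lk → Matrix.specialUnitaryGroup n ℂ) :
    sunExpDrift ι hι ε p * (c * U) = c * (sunExpDrift ι hι ε p * U) := by
  funext l
  simp only [Pi.mul_apply]
  rw [← mul_assoc, ← mul_assoc, (Subgroup.mem_center_iff.1 (hc l) (sunExpDrift ι hι ε p l))]

/-- **The `n`-step proposal commutes with every configuration of central left factors its increment is blind to**:
`Ψ_n(c·U, p) = (c·(Ψ_n(U,p)).1, (Ψ_n(U,p)).2)`. -/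
theorem sunLeapfrogProposalN_centerMul (hgc : ∀ U, g (c * U) = g U) (N : ℕ) (z : (Lk → Matrix.specialUnitaryGroup n ℂ) × (Lk → E)) :
    sunLeapfrogProposalN ι hι ε g N (c * z.1, z.2) =
      (c * (sunLeapfrogProposalN ι hι ε g N z).1, (sunLeapfrogProposalN ι hι ε g N z).2) := by
  set Tc : (Lk → Matrix.specialUnitaryGroup n ℂ) × (Lk → E) → (Lk → Matrix.specialUnitaryGroup n ℂ) × (Lk → E) :=
    fun z => (c * z.1, z.2) with hTc
  have hkick : Function.Semiconj Tc (⇑(kick g)) (⇑(kick g)) := by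
    intro z
    simp only [hTc, kick, Equiv.coe_fn_mk, hgc]
  have hdrift : Function.Semiconj Tc (⇑(drift (mulDrift (sunExpDrift ι hι ε)))) (⇑(drift (mulDrift (sunExpDrift ι hι ε)))) := by
    intro z
    simp only [hTc, drift, mulDrift, Equiv.coe_fn_mk, Equiv.coe_mulLeft, sunExpDrift_mul_centerMul ι hι ε hc]
  have hflip : Function.Semiconj Tc (⇑(flip : Equiv.Perm ((Lk → Matrix.specialUnitaryGroup n ℂ) × (Lk → E))))
      (⇑(flip : Equiv.Perm ((Lk → Matrix.specialUnitaryGroup n ℂ) × (Lk → E)))) := by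
    intro z
    simp only [hTc, flip_apply]
  have hword : Function.Semiconj Tc (⇑(sunLeapfrogProposalN ι hι ε g N)) (⇑(sunLeapfrogProposalN ι hι ε g N)) := by
    unfold sunLeapfrogProposalN palindromicWord
    simp only [List.reverse_singleton, List.prod_singleton, Equiv.Perm.coe_mul, Equiv.Perm.coe_pow]
    exact hflip.comp_right (((hkick.comp_right hdrift).comp_right hkick).iterate_right N)
  exact (hword z).symm

variable (N : ℕ) [Fintype Lk] [MeasurableSpace E] [BorelSpace E] (μ : Measure E) {T : (Lk → E) → ℝ} [FiniteDimensional ℝ E]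
  (hg : Measurable g)

/-- **THE ENGINE KERNEL COMMUTES WITH EVERY CENTRAL LEFT MULTIPLICATION ITS DATA RESPECT**: for a measurable bijection `Θ` acting
as `U ↦ c·U` (`c` central link by link), an increment with `g(c·U) = g(U)` and a measurable action with `S(c·U) = S(U)`
(measurable kinetic energy `T`, s-finite momentum law): `conjKernel (sunLeapfrogHMCN …) Θ = sunLeapfrogHMCN …`. -/
theorem conjKernel_sunLeapfrogHMCN_of_centerMul [SFinite (sunMomentumLaw (L := Lk) μ T)]
    {S : (Lk → Matrix.specialUnitaryGroup n ℂ) → ℝ} (hS : Measurable S) (hTm : Measurable T)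
    (Θ : (Lk → Matrix.specialUnitaryGroup n ℂ) ≃ᵐ (Lk → Matrix.specialUnitaryGroup n ℂ)) (hΘ : ∀ U, Θ U = c * U)
    (hgc : ∀ U, g (c * U) = g U) (hSc : ∀ U, S (c * U) = S U) :
    conjKernel (sunLeapfrogHMCN ι hι ε μ T hg S N) Θ = sunLeapfrogHMCN ι hι ε μ T hg S N := by
  unfold sunLeapfrogHMCN
  refine conjKernel_refreshUpdate_eq_self _ _ Θ (MeasurableEquiv.refl _)
    (by rw [show (⇑(MeasurableEquiv.refl (Lk → E)) : (Lk → E) → Lk → E) = id from rfl, Measure.map_id])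
    (conjKernel_involMH_of_comm ((hS.comp measurable_fst).add (hTm.comp measurable_snd)) _ (fun z => ?_) (fun z => ?_))
  · show sunLeapfrogProposalN ι hι ε g N (Θ z.1, z.2) = (Θ (sunLeapfrogProposalN ι hι ε g N z).1, (sunLeapfrogProposalN ι hι ε g N z).2)
    rw [hΘ, hΘ]
    exact sunLeapfrogProposalN_centerMul ι hι ε hc hgc N z
  · show S (Θ z.1) + T z.2 = S z.1 + T z.2
    rw [hΘ, hSc]

end Central

/-! ## §2 The two arms as run commute with the centre transformation -/

section Arms

variable (N : ℕ) {d L : ℕ} [NeZero d] [NeZero L] {z : Matrix.specialUnitaryGroup (Fin N) ℂ}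
  (hz : z ∈ Subgroup.center (Matrix.specialUnitaryGroup (Fin N) ℂ)) (t₀ : ZMod L)
include hz

omit [NeZero L] in
/-- **The Wilson force is centre blind**: `F(z·U) = F(U)` (row 21's `plaquetteLoopSum_centerTwist`). -/
theorem sunWilsonForce_centerTwist (β : ℝ) (U : GaugeConfig d L (Matrix.specialUnitaryGroup (Fin N) ℂ)) :
    sunWilsonForce N β (centerTwist z t₀ U) = sunWilsonForce N β U := by
  funext e
  simp only [sunWilsonForce, Scoring.plaquetteLoopSum_centerTwist hz]

omit [NeZero L] in
/-- **Every plaquette-weighted loop sum is centre blind**: `Ω^w_{x,μ}(z·V) = Ω^w_{x,μ}(V)`. -/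
theorem weightedLoopSum_centerTwist (w : Plaquette d L → ℝ) (V : GaugeConfig d L (Matrix.specialUnitaryGroup (Fin N) ℂ))
    (x : Site d L) (μ : Fin d) :
    weightedLoopSum w (centerTwist z t₀ V) x μ = weightedLoopSum w V x μ := by
  unfold weightedLoopSum
  refine Finset.sum_congr rfl fun ν _ => ?_
  split_ifs with h
  · rfl
  · rw [plaquetteHolonomy_centerTwist hz, plaquetteHolonomy_centerTwist hz, Scoring.inv_mul_mul_centerTwist hz]

omit [NeZero L] in
/-- **Every plaquette-weighted force is centre blind**, in particular the open-boundary force. -/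
theorem sunWeightedForce_centerTwist (w : Plaquette d L → ℝ) (β : ℝ) (U : GaugeConfig d L (Matrix.specialUnitaryGroup (Fin N) ℂ)) :
    sunWeightedForce N w β (centerTwist z t₀ U) = sunWeightedForce N w β U := by
  funext e
  simp only [sunWeightedForce, weightedLoopSum_centerTwist N hz]

/-- **THE PERIODIC HMC ARM AS RUN COMMUTES WITH THE CENTRE TRANSFORMATION** (every central `z`, slice `t₀`, `β, ε, nstep, L`). -/
theorem conjKernel_wilsonForce_sunLeapfrogHMCN_centerTwist (β ε : ℝ) (nstep : ℕ) :
    conjKernel (sunLeapfrogHMCN (sunCoordι N) (sunCoordι_skew N) ε (Measure.addHaar : Measure (SUNCoords N)) (sunKinetic N)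
        (measurable_halfKick_sun N (measurable_sunWilsonForce N (d := d) (L := L) β) ε)
        (fun U => β * wilsonAction (suRep N) U) nstep) (centerTwistEquiv z t₀) =
      sunLeapfrogHMCN (sunCoordι N) (sunCoordι_skew N) ε (Measure.addHaar : Measure (SUNCoords N)) (sunKinetic N)
        (measurable_halfKick_sun N (measurable_sunWilsonForce N (d := d) (L := L) β) ε)
        (fun U => β * wilsonAction (suRep N) U) nstep :=
  conjKernel_sunLeapfrogHMCN_of_centerMul (sunCoordι N) (sunCoordι_skew N) ε
    (fun l => twistConfig_mem_center (d := d) (L := L) hz t₀ l) nstep Measure.addHaar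
    (measurable_halfKick_sun N (measurable_sunWilsonForce N β) ε)
    ((continuous_smul_wilsonAction (suRep N) continuous_suRep β).measurable) (measurable_sunKinetic N)
    (centerTwistEquiv z t₀) (fun U => rfl)
    (fun U => by show (-(ε / 2)) • sunWilsonForce N β (centerTwist z t₀ U) = _; rw [sunWilsonForce_centerTwist N hz])
    (fun U => by show β * wilsonAction (suRep N) (centerTwist z t₀ U) = _; rw [wilsonAction_centerTwist (suRep N) hz])

/-- **THE OPEN-BOUNDARY HMC ARM AS RUN COMMUTES WITH THE CENTRE TRANSFORMATION** (every open direction `τ`). -/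
theorem conjKernel_obcForce_sunLeapfrogHMCN_centerTwist (τ : Fin d) (β ε : ℝ) (nstep : ℕ) :
    conjKernel (sunLeapfrogHMCN (sunCoordι N) (sunCoordι_skew N) ε (Measure.addHaar : Measure (SUNCoords N)) (sunKinetic N)
        (measurable_halfKick_sun N (measurable_sunWeightedForce N (d := d) (L := L) (obcWeight τ) β) ε)
        (fun U => β * obcAction (suRep N) τ U) nstep) (centerTwistEquiv z t₀) =
      sunLeapfrogHMCN (sunCoordι N) (sunCoordι_skew N) ε (Measure.addHaar : Measure (SUNCoords N)) (sunKinetic N)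
        (measurable_halfKick_sun N (measurable_sunWeightedForce N (d := d) (L := L) (obcWeight τ) β) ε)
        (fun U => β * obcAction (suRep N) τ U) nstep :=
  conjKernel_sunLeapfrogHMCN_of_centerMul (sunCoordι N) (sunCoordι_skew N) ε
    (fun l => twistConfig_mem_center (d := d) (L := L) hz t₀ l) nstep Measure.addHaar
    (measurable_halfKick_sun N (measurable_sunWeightedForce N (obcWeight τ) β) ε)
    ((continuous_obcAction (suRep N) continuous_suRep τ).measurable.const_mul β) (measurable_sunKinetic N)
    (centerTwistEquiv z t₀) (fun U => rfl)
    (fun U => by show (-(ε / 2)) • sunWeightedForce N (obcWeight τ) β (centerTwist z t₀ U) = _; rw [sunWeightedForce_centerTwist N hz])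
    (fun U => by show β * obcAction (suRep N) τ (centerTwist z t₀ U) = _; rw [obcAction_centerTwist (suRep N) hz])

end Arms

/-! ## §3 Hot start: `E_t[tr P] = 0` at every step of both runs -/

section HotStart

variable (N : ℕ) {d L : ℕ} [NeZero d] [NeZero L]

/-- **Every centre-covariant observable with phase `ω ≠ 1` has zero mean at every step of the periodic run** from any start
invariant under the centre transformation. -/
theorem integral_wilsonHmcChain_eq_zero_of_centerCovariant (β ε : ℝ) (nstep : ℕ) {z : Matrix.specialUnitaryGroup (Fin N) ℂ}
    (hz : z ∈ Subgroup.center (Matrix.specialUnitaryGroup (Fin N) ℂ)) (t₀ : ZMod L)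
    {μ₀ : Measure (GaugeConfig d L (Matrix.specialUnitaryGroup (Fin N) ℂ))} (hμ₀ : μ₀.map (centerTwistEquiv z t₀) = μ₀) (t : ℕ)
    (F : GaugeConfig d L (Matrix.specialUnitaryGroup (Fin N) ℂ) → ℂ) {ω : ℂ} (hω : ω ≠ 1) (hF : ∀ U, F (centerTwist z t₀ U) = ω * F U) :
    ∫ U, F U ∂(μ₀.bind (nHit (sunLeapfrogHMCN (sunCoordι N) (sunCoordι_skew N) ε (Measure.addHaar : Measure (SUNCoords N))
        (sunKinetic N) (measurable_halfKick_sun N (measurable_sunWilsonForce N (d := d) (L := L) β) ε)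
        (fun U => β * wilsonAction (suRep N) U) nstep) t)) = 0 :=
  integral_eq_zero_of_covariant (centerTwistEquiv z t₀)
    (Scoring.map_bind_nHit_eq_self (conjKernel_wilsonForce_sunLeapfrogHMCN_centerTwist N hz t₀ β ε nstep) hμ₀ t) F hω hF

/-- The same along the open-boundary run. -/
theorem integral_obcHmcChain_eq_zero_of_centerCovariant (τ : Fin d) (β ε : ℝ) (nstep : ℕ)
    {z : Matrix.specialUnitaryGroup (Fin N) ℂ} (hz : z ∈ Subgroup.center (Matrix.specialUnitaryGroup (Fin N) ℂ)) (t₀ : ZMod L)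
    {μ₀ : Measure (GaugeConfig d L (Matrix.specialUnitaryGroup (Fin N) ℂ))} (hμ₀ : μ₀.map (centerTwistEquiv z t₀) = μ₀) (t : ℕ)
    (F : GaugeConfig d L (Matrix.specialUnitaryGroup (Fin N) ℂ) → ℂ) {ω : ℂ} (hω : ω ≠ 1) (hF : ∀ U, F (centerTwist z t₀ U) = ω * F U) :
    ∫ U, F U ∂(μ₀.bind (nHit (sunLeapfrogHMCN (sunCoordι N) (sunCoordι_skew N) ε (Measure.addHaar : Measure (SUNCoords N))
        (sunKinetic N) (measurable_halfKick_sun N (measurable_sunWeightedForce N (d := d) (L := L) (obcWeight τ) β) ε)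
        (fun U => β * obcAction (suRep N) τ U) nstep) t)) = 0 :=
  integral_eq_zero_of_covariant (centerTwistEquiv z t₀)
    (Scoring.map_bind_nHit_eq_self (conjKernel_obcForce_sunLeapfrogHMCN_centerTwist N hz t₀ τ β ε nstep) hμ₀ t) F hω hF

/-- **HOT START, PERIODIC RUN: `E_t[tr P(y)] = 0` AT EVERY STEP** (`SU(N)`, `N ≥ 2`, every base site `y`, every `β, ε, nstep, L`). -/
theorem integral_wilsonHmcHotStart_tracePolyakov_eq_zero (hN : 2 ≤ N) (β ε : ℝ) (nstep t : ℕ) (y : Site d L) :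
    ∫ U, tracePolyakov N y U ∂((Measure.pi fun _ : Edge d L => haarProbability (Matrix.specialUnitaryGroup (Fin N) ℂ)).bind
        (nHit (sunLeapfrogHMCN (sunCoordι N) (sunCoordι_skew N) ε (Measure.addHaar : Measure (SUNCoords N)) (sunKinetic N)
          (measurable_halfKick_sun N (measurable_sunWilsonForce N (d := d) (L := L) β) ε)
          (fun U => β * wilsonAction (suRep N) U) nstep) t)) = 0 := by
  obtain ⟨z, ω, hz, hω, hF⟩ := isCenterCovariant_tracePolyakov (d := d) (L := L) hN y
  exact integral_wilsonHmcChain_eq_zero_of_centerCovariant N β ε nstep hz 0 (map_centerTwist_pi_haar z 0) t (tracePolyakov N y) hω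
    (hF 0)

/-- **HOT START, OPEN-BOUNDARY RUN: `E_t[tr P(y)] = 0` AT EVERY STEP** (every open direction `τ`; the Polyakov line winds
around the periodic direction `0` of the torus that carries the open-boundary weights). -/
theorem integral_obcHmcHotStart_tracePolyakov_eq_zero (hN : 2 ≤ N) (τ : Fin d) (β ε : ℝ) (nstep t : ℕ) (y : Site d L) :
    ∫ U, tracePolyakov N y U ∂((Measure.pi fun _ : Edge d L => haarProbability (Matrix.specialUnitaryGroup (Fin N) ℂ)).bind
        (nHit (sunLeapfrogHMCN (sunCoordι N) (sunCoordι_skew N) ε (Measure.addHaar : Measure (SUNCoords N)) (sunKinetic N)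
          (measurable_halfKick_sun N (measurable_sunWeightedForce N (d := d) (L := L) (obcWeight τ) β) ε)
          (fun U => β * obcAction (suRep N) τ U) nstep) t)) = 0 := by
  obtain ⟨z, ω, hz, hω, hF⟩ := isCenterCovariant_tracePolyakov (d := d) (L := L) hN y
  exact integral_obcHmcChain_eq_zero_of_centerCovariant N τ β ε nstep hz 0 (map_centerTwist_pi_haar z 0) t (tracePolyakov N y) hω
    (hF 0)

end HotStart

end Summit.Ventures.LatticeQCDFlow.Exactness
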